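import Mathlib
import Literature.MathematicalPhysics.QuantumLattice.YangMillsClassical
import Literature.MathematicalPhysics.QuantumLattice.GrassmannIntegralProofs
import Summits.QuantumFields.QCD.Theorems.NestedDissectionSeaEarlyCrosserLawStubKatoSobolevCutoff
import Summits.QuantumFields.QCD.Theorems.NestedDissectionSeaEarlyCrosserLawZeroModeRegularity
import Summits.QuantumFields.QCD.Theorems.NestedDissectionSeaEarlyCrosserLawZeroModeBochner
import Summits.QuantumFields.QCD.Theorems.NestedDissectionSeaEarlyCrosserLawZeroModePointwise
import HarnessLib

/-!
# Zero-mode action floor — the Dirichlet-energy bound through the Bochner trick (lead c7, line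
`zero-mode-floor-dilute-gas` of crux `NestedDissectionSea.EarlyCrosserLaw`, stmt-QuantumFields-13995)

Helper for the registered stub `stub_floorAssembly`.  For a smooth anti-Hermitian connection `A`, a
smooth spinor field `ψ`, a smooth compactly supported cut-off `χ` and `δ > 0`: if the Weitzenböck
divergence identity `Σ_μ ∂_μ Re⟨ψ,∇_μψ⟩ = |∇ψ|² − W` holds pointwise (the registered stub
`stub_weitzenbockDivergence` provides it with `W = Re⟨ψ,𝔉ψ⟩`), then
`∫ χ²|∇ψ|² − ∫ χ² W ≤ δ ∫ χ²|∇ψ|² + δ⁻¹ ∫ ‖dχ‖² |ψ|²`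
(integration by parts against `χ²`, Cauchy–Schwarz, absorption).
-/

noncomputable section

open scoped BigOperators Matrix ContDiff Matrix.Norms.Frobenius
open MeasureTheory Literature.MathematicalPhysics.QuantumLattice

namespace Summit.QuantumFields.QCD.Cruxes.EarlyCrosserLaw.ZeroModeFloorDiluteGas

/-- If the Weitzenböck divergence identity `Σ_μ ∂_μ Re⟨ψ,∇_μψ⟩ = |∇ψ|² − W` holds pointwise for smooth data,
then `W` is continuous. -/
theorem continuous_of_weitzenbock
    (A : Connection (EuclideanSpace ℝ (Fin 4)) (Matrix (Fin 3) (Fin 3) ℂ))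
    (ψ : EuclideanSpace ℝ (Fin 4) → Fin 4 → Fin 3 → ℂ)
    (hA : IsSmoothConnection A) (hψ : ContDiff ℝ ∞ ψ) (W : EuclideanSpace ℝ (Fin 4) → ℝ)
    (hdiv : ∀ x : EuclideanSpace ℝ (Fin 4),
      ∑ μ : Fin 4, fderiv ℝ (fun y => (∑ s, ∑ c, starRingEnd ℂ (ψ y s c) *
        (fderiv ℝ (fun z => ψ z s c) y (EuclideanSpace.single μ (1 : ℝ)) +
          ∑ c' : Fin 3, A y (EuclideanSpace.single μ (1 : ℝ)) c c' * ψ y s c')).re) x (EuclideanSpace.single μ (1 : ℝ))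
      = (∑ μ : Fin 4, ∑ s, ∑ c, ‖fderiv ℝ (fun z => ψ z s c) x (EuclideanSpace.single μ (1 : ℝ)) +
          ∑ c' : Fin 3, A x (EuclideanSpace.single μ (1 : ℝ)) c c' * ψ x s c'‖ ^ 2) - W x) :
    Continuous W := by
  set e : Fin 4 → EuclideanSpace ℝ (Fin 4) := fun μ => EuclideanSpace.single μ (1 : ℝ) with he
  set cov : Fin 4 → EuclideanSpace ℝ (Fin 4) → Fin 4 → Fin 3 → ℂ := fun μ x s c =>
    fderiv ℝ (fun z => ψ z s c) x (e μ) + ∑ c' : Fin 3, A x (e μ) c c' * ψ x s c' with hcov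
  set G : EuclideanSpace ℝ (Fin 4) → ℝ := fun x => ∑ μ : Fin 4, ∑ s, ∑ c, ‖cov μ x s c‖ ^ 2 with hG
  set V : Fin 4 → EuclideanSpace ℝ (Fin 4) → ℝ := fun μ y =>
    (∑ s, ∑ c, starRingEnd ℂ (ψ y s c) * cov μ y s c).re with hV
  have hdiv' : ∀ x, ∑ μ : Fin 4, fderiv ℝ (V μ) x (e μ) = G x - W x := hdiv
  have hVcd : ∀ μ, ContDiff ℝ ∞ (V μ) := fun μ => contDiff_re_inner_covDeriv hA hψ μ
  have hcovc : ∀ μ s c, Continuous fun x => cov μ x s c := fun μ s c =>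
    (contDiff_covDeriv_component hA hψ μ s c).continuous
  have hGc : Continuous G := by
    refine continuous_finsetSum _ fun μ _ => continuous_finsetSum _ fun s _ =>
      continuous_finsetSum _ fun c _ => ((hcovc μ s c).norm).pow 2
  have hdVc : ∀ μ, Continuous fun x => fderiv ℝ (V μ) x (e μ) := fun μ =>
    ((hVcd μ).continuous_fderiv (by simp)).clm_apply continuous_const
  have hWeq : W = fun x => G x - ∑ μ : Fin 4, fderiv ℝ (V μ) x (e μ) := by
    funext x; have := hdiv' x; linarith
  rw [hWeq]
  exact hGc.sub (continuous_finsetSum _ fun μ _ => hdVc μ)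

/-- **Dirichlet bound (Bochner trick + absorption).**  See the module docstring. -/
theorem dirichlet_bound
    (A : Connection (EuclideanSpace ℝ (Fin 4)) (Matrix (Fin 3) (Fin 3) ℂ))
    (ψ : EuclideanSpace ℝ (Fin 4) → Fin 4 → Fin 3 → ℂ)
    (hA : IsSmoothConnection A) (hψ : ContDiff ℝ ∞ ψ) (W : EuclideanSpace ℝ (Fin 4) → ℝ)
    (hdiv : ∀ x : EuclideanSpace ℝ (Fin 4),
      ∑ μ : Fin 4, fderiv ℝ (fun y => (∑ s, ∑ c, starRingEnd ℂ (ψ y s c) *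
        (fderiv ℝ (fun z => ψ z s c) y (EuclideanSpace.single μ (1 : ℝ)) +
          ∑ c' : Fin 3, A y (EuclideanSpace.single μ (1 : ℝ)) c c' * ψ y s c')).re) x (EuclideanSpace.single μ (1 : ℝ))
      = (∑ μ : Fin 4, ∑ s, ∑ c, ‖fderiv ℝ (fun z => ψ z s c) x (EuclideanSpace.single μ (1 : ℝ)) +
          ∑ c' : Fin 3, A x (EuclideanSpace.single μ (1 : ℝ)) c c' * ψ x s c'‖ ^ 2) - W x)
    (χ : EuclideanSpace ℝ (Fin 4) → ℝ) (hχ : ContDiff ℝ ∞ χ) (hχs : HasCompactSupport χ) (δ : ℝ) (hδ : 0 < δ) :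
    (∫ x, χ x ^ 2 * (∑ μ : Fin 4, ∑ s, ∑ c, ‖fderiv ℝ (fun z => ψ z s c) x (EuclideanSpace.single μ (1 : ℝ)) +
          ∑ c' : Fin 3, A x (EuclideanSpace.single μ (1 : ℝ)) c c' * ψ x s c'‖ ^ 2))
      - ∫ x, χ x ^ 2 * W x
    ≤ δ * (∫ x, χ x ^ 2 * (∑ μ : Fin 4, ∑ s, ∑ c, ‖fderiv ℝ (fun z => ψ z s c) x (EuclideanSpace.single μ (1 : ℝ)) +
          ∑ c' : Fin 3, A x (EuclideanSpace.single μ (1 : ℝ)) c c' * ψ x s c'‖ ^ 2))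
      + δ⁻¹ * ∫ x, ‖fderiv ℝ χ x‖ ^ 2 * (∑ s, ∑ c, ‖ψ x s c‖ ^ 2) := by
  -- abbreviations
  set e : Fin 4 → EuclideanSpace ℝ (Fin 4) := fun μ => EuclideanSpace.single μ (1 : ℝ) with he
  set cov : Fin 4 → EuclideanSpace ℝ (Fin 4) → Fin 4 → Fin 3 → ℂ := fun μ x s c =>
    fderiv ℝ (fun z => ψ z s c) x (e μ) + ∑ c' : Fin 3, A x (e μ) c c' * ψ x s c' with hcov
  set G : EuclideanSpace ℝ (Fin 4) → ℝ := fun x => ∑ μ : Fin 4, ∑ s, ∑ c, ‖cov μ x s c‖ ^ 2 with hG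
  set n : EuclideanSpace ℝ (Fin 4) → ℝ := fun x => ∑ s, ∑ c, ‖ψ x s c‖ ^ 2 with hn
  set V : Fin 4 → EuclideanSpace ℝ (Fin 4) → ℝ := fun μ y =>
    (∑ s, ∑ c, starRingEnd ℂ (ψ y s c) * cov μ y s c).re with hV
  -- restate the hypothesis and the goal through the abbreviations
  have hdiv' : ∀ x, ∑ μ : Fin 4, fderiv ℝ (V μ) x (e μ) = G x - W x := hdiv
  show (∫ x, χ x ^ 2 * G x) - ∫ x, χ x ^ 2 * W x ≤ δ * (∫ x, χ x ^ 2 * G x) + δ⁻¹ * ∫ x, ‖fderiv ℝ χ x‖ ^ 2 * n x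
  -- regularity
  have hVcd : ∀ μ, ContDiff ℝ ∞ (V μ) := fun μ => contDiff_re_inner_covDeriv hA hψ μ
  have hcovc : ∀ μ s c, Continuous fun x => cov μ x s c := fun μ s c =>
    (contDiff_covDeriv_component hA hψ μ s c).continuous
  have hGc : Continuous G := by
    refine continuous_finsetSum _ fun μ _ => continuous_finsetSum _ fun s _ =>
      continuous_finsetSum _ fun c _ => ((hcovc μ s c).norm).pow 2
  have hnc : Continuous n := by
    refine continuous_finsetSum _ fun s _ => continuous_finsetSum _ fun c _ => ?_
    exact ((contDiff_pi.1 (contDiff_pi.1 hψ s) c).continuous.norm).pow 2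
  have hVc : ∀ μ, Continuous (V μ) := fun μ => (hVcd μ).continuous
  have hdVc : ∀ μ, Continuous fun x => fderiv ℝ (V μ) x (e μ) := fun μ =>
    ((hVcd μ).continuous_fderiv (by simp)).clm_apply continuous_const
  have hWc : Continuous W := by
    have hWeq : W = fun x => G x - ∑ μ : Fin 4, fderiv ℝ (V μ) x (e μ) := by
      funext x; have := hdiv' x; linarith
    rw [hWeq]
    exact hGc.sub (continuous_finsetSum _ fun μ _ => hdVc μ)
  have hχc : Continuous χ := hχ.continuous
  have hdχc : ∀ μ, Continuous fun x => fderiv ℝ χ x (e μ) := fun μ =>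
    (hχ.continuous_fderiv (by simp)).clm_apply continuous_const
  have hdχn : Continuous fun x => ‖fderiv ℝ χ x‖ ^ 2 := ((hχ.continuous_fderiv (by simp)).norm).pow 2
  -- compact supports
  have hχ2s : HasCompactSupport fun x => χ x ^ 2 := by
    have : (fun x => χ x ^ 2) = fun x => χ x * χ x := funext fun x => sq _
    rw [this]; exact hχs.mul_right
  have hdχs : HasCompactSupport fun x => ‖fderiv ℝ χ x‖ ^ 2 := by
    have h1 : HasCompactSupport fun x => ‖fderiv ℝ χ x‖ := (hχs.fderiv (𝕜 := ℝ)).norm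
    have : (fun x => ‖fderiv ℝ χ x‖ ^ 2) = fun x => ‖fderiv ℝ χ x‖ * ‖fderiv ℝ χ x‖ := funext fun x => sq _
    rw [this]; exact h1.mul_right
  -- integrability of everything in sight
  have iG : Integrable fun x => χ x ^ 2 * G x := ((hχc.pow 2).mul hGc).integrable_of_hasCompactSupport hχ2s.mul_right
  have iW : Integrable fun x => χ x ^ 2 * W x := ((hχc.pow 2).mul hWc).integrable_of_hasCompactSupport hχ2s.mul_right
  have iE : Integrable fun x => ‖fderiv ℝ χ x‖ ^ 2 * n x := (hdχn.mul hnc).integrable_of_hasCompactSupport hdχs.mul_right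
  have iB : Integrable fun x => χ x * ∑ μ : Fin 4, fderiv ℝ χ x (e μ) * V μ x :=
    (hχc.mul (continuous_finsetSum _ fun μ _ => (hdχc μ).mul (hVc μ))).integrable_of_hasCompactSupport hχs.mul_right
  -- E1: the Bochner trick
  have hIBP := integral_sq_mul_divergence V (fun μ => (hVcd μ).of_le (by exact_mod_cast le_top)) χ hχ hχs
  have hE1 : (∫ x, χ x ^ 2 * G x) - ∫ x, χ x ^ 2 * W x
      = -2 * ∫ x, χ x * ∑ μ : Fin 4, fderiv ℝ χ x (e μ) * V μ x := by
    rw [← hIBP, ← integral_sub iG iW]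
    refine integral_congr_ae (ae_of_all _ fun x => ?_)
    show χ x ^ 2 * G x - χ x ^ 2 * W x = χ x ^ 2 * ∑ μ : Fin 4, fderiv ℝ (V μ) x (e μ)
    rw [hdiv' x]
    ring
  -- E2: absorption, pointwise then integrated
  have hpt : ∀ x, -2 * (χ x * ∑ μ : Fin 4, fderiv ℝ χ x (e μ) * V μ x)
      ≤ δ * (χ x ^ 2 * G x) + δ⁻¹ * (‖fderiv ℝ χ x‖ ^ 2 * n x) := by
    intro x
    have h := absorb_pointwise (χ x) (n x) δ (fun μ => fderiv ℝ χ x (e μ)) (fun μ => V μ x)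
      (fun μ => ∑ s, ∑ c, ‖cov μ x s c‖ ^ 2) hδ
      (Finset.sum_nonneg fun s _ => Finset.sum_nonneg fun c _ => sq_nonneg _)
      (fun μ => Finset.sum_nonneg fun s _ => Finset.sum_nonneg fun c _ => sq_nonneg _)
      (fun μ => re_inner_sq_le (ψ x) (cov μ x))
    rw [katoSobolev_opNorm_sq_eq_sum (fderiv ℝ χ x)]
    exact h
  have hE2 : -2 * (∫ x, χ x * ∑ μ : Fin 4, fderiv ℝ χ x (e μ) * V μ x)
      ≤ δ * (∫ x, χ x ^ 2 * G x) + δ⁻¹ * ∫ x, ‖fderiv ℝ χ x‖ ^ 2 * n x := by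
    rw [← integral_const_mul, ← integral_const_mul, ← integral_const_mul, ← integral_add (iG.const_mul δ) (iE.const_mul δ⁻¹)]
    exact integral_mono (iB.const_mul (-2)) ((iG.const_mul δ).add (iE.const_mul δ⁻¹)) fun x => hpt x
  linarith [hE1, hE2]

end Summit.QuantumFields.QCD.Cruxes.EarlyCrosserLaw.ZeroModeFloorDiluteGas

end
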